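import Summits.Ventures.PercRepro.Night2NearFatSix
import Summits.Ventures.PercRepro.Night2NearFatSixLine
import Summits.Ventures.PercRepro.Night2NearFatCells

/-!
# night-2: THE LOADS OF A BASIS PAIR AT `|W| = 10` ABOVE LEVEL FIVE (gen 40)

At `|W| = 10` the non-suspect family lives at the levels `≥ 6 = |W| − 4`.  A load there is a distance-1 good target, or a
distance-2 target of a lossy big set with no good point whose rank-2 set `R` has `|R| = |Y| = 6 = |V| − 9`, so
`V ∩ cl R = R` is the six-point three-planar line — UNIQUE (Night2NearFatSixLine) — and `Y ⊇ R ∖ Q`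
(`exists_good_or_six_of_dload_ne_zero`).  Hence: with no six-line every load above level five is a distance-1 load and the
shape lemma holds (`dload_eq_zero_of_shape_of_no_six`); with the six-line `R₀` the shape lemma holds for the `Y` not containing
`R₀ ∖ Q` at level `6` (`dload_eq_zero_of_shape_of_six`).  The cells of `ntpIncomeX 10 6 · · · · 15` (`15 = C(6, 2)` bounds the
supersets of the `≥ 4` points of `R₀ ∖ Q`): `(0,0,8,0)`, `(5,0,8,0)`, `(6,0,7,0)`, `(5,5,6,0)`.  Paper: proofs/NIGHT-2-g40.md §9.
-/

namespace PercRepro.Shadow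

open PercRepro.ThmH PercRepro.PerFlat

variable {α : Type*} [DecidableEq α] {M : Matroid α} [M.Finite] {G : Finset α}

/-- **The core of the shape lemma**: no rank-2 set `R ⊆ T′` with `|T′| = |R| + 4` when `Y` has `≤ |Y| − 2` points on every
basis line and lies inside no line through a basis point. -/
theorem not_exists_rank_two_of_shape (hG : G ∈ flatsQ M (5 + 1)) (hd : (gr M \ G).card = 2)
    (hk : kColoops M G = 1) (hs : ∀ e ∈ gr M, ∀ f ∈ gr M, e ≠ f → rkN M {e, f} = 2)
    {B : Finset α} (hB : B ∈ thinMembers M 5 G) (hnP : ¬ bigP M G B) {z : α} (hz : z ∈ G \ clF M B)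
    {Y : Finset α} (hY : Y ⊆ G \ insert z B)
    (h2 : ∀ a ∈ insert z B \ coloops M G, ∀ b ∈ insert z B \ coloops M G, a ≠ b →
      (Y ∩ clF M {a, b}).card + 2 ≤ Y.card)
    (h1 : ∀ a ∈ insert z B \ coloops M G, ∀ y ∈ Y, ¬ Y ⊆ clF M {a, y}) {R : Finset α}
    (hRT : R ⊆ (insert z B ∪ Y) \ coloops M G) (hR2 : rkN M R = 2)
    (hcard : ((insert z B ∪ Y) \ coloops M G).card = R.card + 4) : False := by
  have hGg : G ⊆ gr M := (mem_flatsQ.1 hG).1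
  have hBG : B ⊆ G := subset_G_of_mem_thinMembers hB
  have hQG : insert z B ⊆ G := Finset.insert_subset (Finset.mem_sdiff.1 hz).1 hBG
  have hT'K := union_sdiff_coloops_eq_of_subset hG hd hB (z := z) hY
  have hcardT := card_union_sdiff_coloops_eq hG hd hk hB hnP hz hY
  have hind : M.Indep ((insert z B \ coloops M G : Finset α) : Set α) :=
    (indep_insert_of_basis_pair hG hd hk hB hnP hz).subset (by exact_mod_cast (Finset.sdiff_subset))
  have hRQ' : (R ∩ (insert z B \ coloops M G)).card ≤ 2 := by
    rw [Finset.inter_comm]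
    exact card_inter_le_two_of_indep_of_rkN_le_two hind hR2.le
  have hRg : R ⊆ gr M :=
    hRT.trans (Finset.sdiff_subset.trans ((Finset.union_subset hQG (hY.trans Finset.sdiff_subset)).trans hGg))
  have hRsub : R ⊆ (R ∩ (insert z B \ coloops M G)) ∪ (R ∩ Y) := by
    intro r hr
    have hrT := hRT hr
    rw [hT'K, Finset.mem_union] at hrT
    rcases hrT with h | h
    · exact Finset.mem_union_left _ (Finset.mem_inter.2 ⟨hr, h⟩)
    · exact Finset.mem_union_right _ (Finset.mem_inter.2 ⟨hr, h⟩)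
  have hRY : R.card ≤ (R ∩ (insert z B \ coloops M G)).card + (R ∩ Y).card := by
    have h1' := Finset.card_le_card hRsub
    have h2' := Finset.card_union_le (R ∩ (insert z B \ coloops M G)) (R ∩ Y)
    omega
  have hRcard : R.card = Y.card + 1 := by omega
  have hpairg : ∀ u v : α, u ∈ G → v ∈ G → ({u, v} : Finset α) ⊆ gr M := by
    intro u v hu hv e he
    rw [Finset.mem_insert, Finset.mem_singleton] at he
    rcases he with rfl | rfl
    · exact hGg hu
    · exact hGg hv
  have hline : ∀ u v : α, u ∈ G → v ∈ G → u ≠ v → u ∈ R → v ∈ R → R ⊆ clF M {u, v} := by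
    intro u v hu hv huv huR hvR
    exact subset_clF_of_rkN_le_two_of_two_mem hs hRg hR2.le huR hvR huv
      (subset_clF_of_subset_gr (hpairg u v hu hv) (Finset.mem_insert_self _ _))
      (subset_clF_of_subset_gr (hpairg u v hu hv) (Finset.mem_insert_of_mem (Finset.mem_singleton_self _)))
  have hWmem : ∀ y ∈ Y, y ∈ G := fun y hy => (Finset.mem_sdiff.1 (hY hy)).1
  have hQmem : ∀ a ∈ insert z B \ coloops M G, a ∈ G := fun a ha => hQG (Finset.mem_sdiff.1 ha).1
  rcases Nat.lt_or_ge (R ∩ (insert z B \ coloops M G)).card 1 with hr0 | hr1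
  · -- no basis point: `|R ∩ Y| ≥ |Y| + 1`, impossible
    have := Finset.card_le_card (Finset.inter_subset_right (s₁ := R) (s₂ := Y))
    omega
  · rcases Nat.lt_or_ge (R ∩ (insert z B \ coloops M G)).card 2 with hr1' | hr2
    · -- one basis point `a`: `Y ⊆ R ⊆ cl {a, y}`
      obtain ⟨a, ha⟩ := Finset.card_pos.1 (show 0 < (R ∩ (insert z B \ coloops M G)).card by omega)
      have hRY' : Y.card ≤ (R ∩ Y).card := by omega
      have hYR : Y ⊆ R := by
        have hsub : R ∩ Y ⊆ Y := Finset.inter_subset_right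
        have heq : R ∩ Y = Y := Finset.eq_of_subset_of_card_le hsub hRY'
        intro y hy
        rw [← heq] at hy
        exact (Finset.mem_inter.1 hy).1
      have hYne : Y.Nonempty := by
        rw [← Finset.card_pos]
        have := rkN_le_card (M := M) R
        omega
      obtain ⟨y, hy⟩ := hYne
      have hay : a ≠ y := by
        intro h
        subst h
        exact (Finset.mem_sdiff.1 (hY hy)).2 (Finset.mem_sdiff.1 (Finset.mem_inter.1 ha).2).1
      have hsub := hline a y (hQmem a (Finset.mem_inter.1 ha).2) (hWmem y hy) hay
        (Finset.mem_inter.1 ha).1 (hYR hy)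
      exact h1 a (Finset.mem_inter.1 ha).2 y hy (hYR.trans hsub)
    · -- two basis points `a ≠ b`: `|Y ∩ cl {a, b}| ≥ |Y| − 1`
      obtain ⟨a, ha, b, hb, hab⟩ := Finset.one_lt_card.1 (show 1 < (R ∩ (insert z B \ coloops M G)).card by omega)
      have hsub := hline a b (hQmem a (Finset.mem_inter.1 ha).2) (hQmem b (Finset.mem_inter.1 hb).2) hab
        (Finset.mem_inter.1 ha).1 (Finset.mem_inter.1 hb).1
      have hc : R ∩ Y ⊆ Y ∩ clF M {a, b} := fun r hr =>
        Finset.mem_inter.2 ⟨(Finset.mem_inter.1 hr).2, hsub (Finset.mem_inter.1 hr).1⟩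
      have hc' := Finset.card_le_card hc
      have hb' := h2 a (Finset.mem_inter.1 ha).2 b (Finset.mem_inter.1 hb).2 hab
      omega



/-- **A load above level `|W| − 4` is a distance-1 load or a six-line load**: the latter has `Y ⊇ R ∖ Q` for the rank-2 set
`R` of a lossy big set with no good point, `|R| = |Y|`, `|V ∩ cl R| + 9 = |V|` and `|Y| + 4 = |W|`. -/
theorem exists_good_or_six_of_dload_ne_zero (hG : G ∈ flatsQ M (5 + 1)) (hd : (gr M \ G).card = 2)
    (hk : kColoops M G = 1) (hs : ∀ e ∈ gr M, ∀ f ∈ gr M, e ≠ f → rkN M {e, f} = 2)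
    (hl : ∀ e ∈ gr M, M.Indep {e}) (hnf : fatClosures M 5 G 2 = ∅) {B : Finset α} (hB : B ∈ thinMembers M 5 G)
    (hnP : ¬ bigP M G B) {z : α} (hz : z ∈ G \ clF M B) {Y : Finset α} (hY : Y ⊆ G \ insert z B)
    (htop : (G \ insert z B).card ≤ Y.card + 4)
    (hne : dload M 5 G (bigP M G) (dshGT2 M 5 G) (insert z B ∪ Y) ≠ 0) :
    (∃ B' ∈ thinMembers M 5 G, 5 ≤ (B' \ coloops M G).card ∧ ∃ z' ∈ G \ clF M B', loss M 5 G B' z' ≠ 0 ∧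
      ∃ x ∈ gtPts M 5 G (insert z' B'), insert z B ∪ Y = insert x (insert z' B')) ∨
    (∃ B' ∈ thinMembers M 5 G, 5 ≤ (B' \ coloops M G).card ∧ ∃ z' ∈ G \ clF M B', loss M 5 G B' z' ≠ 0 ∧
      gtPts M 5 G (insert z' B') = ∅ ∧ ∃ R ⊆ insert z' B' \ coloops M G, rkN M R = 2 ∧
        R.card + 3 = (insert z' B' \ coloops M G).card ∧ R.card = Y.card ∧
        ((G \ coloops M G) ∩ clF M R).card + 9 = (G \ coloops M G).card ∧ Y.card + 4 = (G \ insert z B).card ∧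
        R \ insert z B ⊆ Y) := by
  have hfat : (fatClosures M 5 G 2).card ≤ 1 := by
    rw [hnf, Finset.card_empty]
    exact zero_le_one
  obtain ⟨B', hB', hbig, z', hz', hloss, hcase⟩ := exists_pair_of_dload_ne_zero' hG hd hk hs hl hfat hne
  rcases hcase with ⟨-, x, hx, heq⟩ | ⟨hno, p, hp, heq⟩
  · exact Or.inl ⟨B', hB', hbig, z', hz', hloss, x, hx, heq⟩
  · right
    have hempty : gtPts M 5 G (insert z' B') = ∅ := Finset.not_nonempty_iff_eq_empty.1 hno
    obtain ⟨R, hRQ, hR2, hRcard⟩ := exists_rank_two_of_loss_ne_zero hG hd hk hs hl hB' hbig hz' hloss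
    have h9 := card_inter_clF_add_nine_le_of_gtPts_eq_empty hG hd hk hs hl hnf hB' hbig hz' hloss hRQ hR2 hRcard hempty
    have hGg : G ⊆ gr M := (mem_flatsQ.1 hG).1
    have hQ'G : insert z' B' ⊆ G :=
      Finset.insert_subset (Finset.mem_sdiff.1 hz').1 (subset_G_of_mem_thinMembers hB')
    have hKB' : coloops M G ⊆ B' := coloops_subset_of_mem_thinMembers hG (by omega) hB'
    rw [mem_d2Pts] at hp
    obtain ⟨⟨hp1, hp2⟩, hp12, -⟩ := hp
    have hp1K : p.1 ∉ coloops M G := fun h => (Finset.mem_sdiff.1 hp1).2 (Finset.mem_insert_of_mem (hKB' h))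
    have hp2K : p.2 ∉ coloops M G := fun h => (Finset.mem_sdiff.1 hp2).2 (Finset.mem_insert_of_mem (hKB' h))
    have hT' : (insert z B ∪ Y) \ coloops M G = insert p.1 (insert p.2 (insert z' B' \ coloops M G)) := by
      rw [heq, insert_sdiff_coloops_eq hp1K, insert_sdiff_coloops_eq hp2K]
    have hcardT := card_union_sdiff_coloops_eq hG hd hk hB hnP hz hY
    have hcardT' := hcardT
    rw [hT', Finset.card_insert_of_notMem, Finset.card_insert_of_notMem
      (fun h => (Finset.mem_sdiff.1 hp2).2 (Finset.mem_sdiff.1 h).1)] at hcardT'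
    · have hRsub : R ⊆ (G \ coloops M G) ∩ clF M R := by
        intro r hr
        rw [Finset.mem_inter]
        exact ⟨Finset.mem_sdiff.2 ⟨hQ'G (Finset.mem_sdiff.1 (hRQ hr)).1, (Finset.mem_sdiff.1 (hRQ hr)).2⟩,
          subset_clF_of_subset_gr (hRQ.trans (Finset.sdiff_subset.trans (hQ'G.trans hGg))) hr⟩
      have hRle := Finset.card_le_card hRsub
      have hW := card_sdiff_insert_eq_card_sub_six hG hd hk hB hnP hz
      have hk1 : (coloops M G).card = 1 := by
        rw [← kColoops_eq_card_coloops]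
        exact hk
      have hKG : coloops M G ⊆ G := by
        unfold coloops
        exact Finset.filter_subset _ _
      have hV : (G \ coloops M G).card = G.card - 1 := by
        rw [Finset.card_sdiff_of_subset hKG, hk1]
      have hQ6 : 6 ≤ G.card := by
        have hQG : insert z B ⊆ G := Finset.insert_subset (Finset.mem_sdiff.1 hz).1 (subset_G_of_mem_thinMembers hB)
        have h5 := (rkN_insert_sdiff_coloops_eq_five hG hd hk hB hnP hz).2
        have hKQ : coloops M G ⊆ insert z B :=
          fun x hx => Finset.mem_insert_of_mem (coloops_subset_of_mem_thinMembers hG (by omega) hB hx)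
        have := Finset.card_sdiff_of_subset hKQ
        have := Finset.card_le_card hQG
        omega
      refine ⟨B', hB', hbig, z', hz', hloss, hempty, R, hRQ, hR2, hRcard, by omega, by omega, by omega, ?_⟩
      -- `R ⊆ T′ = Q′ ∪ Y`, so `R ∖ Q ⊆ Y`
      have hRT : R ⊆ (insert z B ∪ Y) \ coloops M G := by
        rw [hT']
        exact hRQ.trans ((Finset.subset_insert _ _).trans (Finset.subset_insert _ _))
      intro r hr
      rw [Finset.mem_sdiff] at hr
      have := hRT hr.1
      rw [Finset.mem_sdiff, Finset.mem_union] at this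
      rcases this.1 with h | h
      · exact absurd h hr.2
      · exact h
    · rw [Finset.mem_insert, Finset.mem_sdiff, not_or]
      exact ⟨hp12, fun h => (Finset.mem_sdiff.1 hp1).2 h.1⟩

/-- **The shape lemma above level `|W| − 4` with no six-line**: if no lossy big set without good point has a line of
`|V| − 9` points, every non-suspect target at a level `≥ |W| − 4` is unloaded. -/
theorem dload_eq_zero_of_shape_of_no_six (hG : G ∈ flatsQ M (5 + 1)) (hd : (gr M \ G).card = 2)
    (hk : kColoops M G = 1) (hs : ∀ e ∈ gr M, ∀ f ∈ gr M, e ≠ f → rkN M {e, f} = 2)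
    (hl : ∀ e ∈ gr M, M.Indep {e}) (hnf : fatClosures M 5 G 2 = ∅)
    (hnosix : ¬ ∃ B' ∈ thinMembers M 5 G, 5 ≤ (B' \ coloops M G).card ∧ ∃ z' ∈ G \ clF M B',
      loss M 5 G B' z' ≠ 0 ∧ gtPts M 5 G (insert z' B') = ∅ ∧ ∃ R ⊆ insert z' B' \ coloops M G, rkN M R = 2 ∧
        R.card + 3 = (insert z' B' \ coloops M G).card ∧
        ((G \ coloops M G) ∩ clF M R).card + 9 = (G \ coloops M G).card)
    {B : Finset α} (hB : B ∈ thinMembers M 5 G) (hnP : ¬ bigP M G B) {z : α} (hz : z ∈ G \ clF M B)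
    {Y : Finset α} (hY : Y ⊆ G \ insert z B) (htop : (G \ insert z B).card ≤ Y.card + 4)
    (h2 : ∀ a ∈ insert z B \ coloops M G, ∀ b ∈ insert z B \ coloops M G, a ≠ b →
      (Y ∩ clF M {a, b}).card + 2 ≤ Y.card)
    (h1 : ∀ a ∈ insert z B \ coloops M G, ∀ y ∈ Y, ¬ Y ⊆ clF M {a, y}) :
    dload M 5 G (bigP M G) (dshGT2 M 5 G) (insert z B ∪ Y) = 0 := by
  by_contra hne
  rcases exists_good_or_six_of_dload_ne_zero hG hd hk hs hl hnf hB hnP hz hY htop hne with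
    ⟨B', hB', hbig, z', hz', hloss, x, hx, heq⟩ | ⟨B', hB', hbig, z', hz', hloss, hempty, R, hRQ, hR2, hRcard, -, h9, -, -⟩
  · -- the distance-1 structure: the rank-2 set with `|T′| = |R| + 4`
    obtain ⟨R, hRQ, hR2, hRcard⟩ := exists_rank_two_of_loss_ne_zero hG hd hk hs hl hB' hbig hz' hloss
    have hxQ : x ∈ G \ insert z' B' := (mem_goodPts.1 hx).1
    have hKB' : coloops M G ⊆ B' := coloops_subset_of_mem_thinMembers hG (by omega) hB'
    have hxK : x ∉ coloops M G := fun h => (Finset.mem_sdiff.1 hxQ).2 (Finset.mem_insert_of_mem (hKB' h))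
    have heq' : (insert z B ∪ Y) \ coloops M G = insert x (insert z' B' \ coloops M G) := by
      rw [heq, insert_sdiff_coloops_eq hxK]
    refine not_exists_rank_two_of_shape hG hd hk hs hB hnP hz hY h2 h1 (R := R)
      (hRQ.trans (by rw [heq']; exact Finset.subset_insert _ _)) hR2 ?_
    rw [heq', Finset.card_insert_of_notMem (fun h => (Finset.mem_sdiff.1 hxQ).2 (Finset.mem_sdiff.1 h).1)]
    omega
  · exact hnosix ⟨B', hB', hbig, z', hz', hloss, hempty, R, hRQ, hR2, hRcard, h9⟩

/-- **The shape lemma above level `|W| − 4` with the six-line** (`|V| = 15`): a non-suspect target at a level `≥ 6` not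
containing `R₀ ∖ Q` at level `6` is unloaded. -/
theorem dload_eq_zero_of_shape_of_six (hG : G ∈ flatsQ M (5 + 1)) (hd : (gr M \ G).card = 2)
    (hk : kColoops M G = 1) (hs : ∀ e ∈ gr M, ∀ f ∈ gr M, e ≠ f → rkN M {e, f} = 2)
    (hl : ∀ e ∈ gr M, M.Indep {e}) (hnf : fatClosures M 5 G 2 = ∅) (h15 : (G \ coloops M G).card = 15)
    {B₀ : Finset α} (hB₀ : B₀ ∈ thinMembers M 5 G) (hbig₀ : 5 ≤ (B₀ \ coloops M G).card) {z₀ : α}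
    (hz₀ : z₀ ∈ G \ clF M B₀) (hloss₀ : loss M 5 G B₀ z₀ ≠ 0) {R₀ : Finset α}
    (hRQ₀ : R₀ ⊆ insert z₀ B₀ \ coloops M G) (hR2₀ : rkN M R₀ = 2)
    (hRcard₀ : R₀.card + 3 = (insert z₀ B₀ \ coloops M G).card) (hempty₀ : gtPts M 5 G (insert z₀ B₀) = ∅)
    (h6₀ : ((G \ coloops M G) ∩ clF M R₀).card = 6)
    {B : Finset α} (hB : B ∈ thinMembers M 5 G) (hnP : ¬ bigP M G B) {z : α} (hz : z ∈ G \ clF M B)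
    {Y : Finset α} (hY : Y ⊆ G \ insert z B) (htop : (G \ insert z B).card ≤ Y.card + 4)
    (h2 : ∀ a ∈ insert z B \ coloops M G, ∀ b ∈ insert z B \ coloops M G, a ≠ b →
      (Y ∩ clF M {a, b}).card + 2 ≤ Y.card)
    (h1 : ∀ a ∈ insert z B \ coloops M G, ∀ y ∈ Y, ¬ Y ⊆ clF M {a, y})
    (hsix : ¬ (Y.card = 6 ∧ ((G \ coloops M G) ∩ clF M R₀) \ insert z B ⊆ Y)) :
    dload M 5 G (bigP M G) (dshGT2 M 5 G) (insert z B ∪ Y) = 0 := by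
  by_contra hne
  rcases exists_good_or_six_of_dload_ne_zero hG hd hk hs hl hnf hB hnP hz hY htop hne with
    ⟨B', hB', hbig, z', hz', hloss, x, hx, heq⟩ |
    ⟨B', hB', hbig, z', hz', hloss, hempty, R, hRQ, hR2, hRcard, hRY, h9, hY4, hRsub⟩
  · obtain ⟨R, hRQ, hR2, hRcard⟩ := exists_rank_two_of_loss_ne_zero hG hd hk hs hl hB' hbig hz' hloss
    have hxQ : x ∈ G \ insert z' B' := (mem_goodPts.1 hx).1
    have hKB' : coloops M G ⊆ B' := coloops_subset_of_mem_thinMembers hG (by omega) hB'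
    have hxK : x ∉ coloops M G := fun h => (Finset.mem_sdiff.1 hxQ).2 (Finset.mem_insert_of_mem (hKB' h))
    have heq' : (insert z B ∪ Y) \ coloops M G = insert x (insert z' B' \ coloops M G) := by
      rw [heq, insert_sdiff_coloops_eq hxK]
    refine not_exists_rank_two_of_shape hG hd hk hs hB hnP hz hY h2 h1 (R := R)
      (hRQ.trans (by rw [heq']; exact Finset.subset_insert _ _)) hR2 ?_
    rw [heq', Finset.card_insert_of_notMem (fun h => (Finset.mem_sdiff.1 hxQ).2 (Finset.mem_sdiff.1 h).1)]
    omega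
  · apply hsix
    have hGg : G ⊆ gr M := (mem_flatsQ.1 hG).1
    have hQ'G : insert z' B' ⊆ G :=
      Finset.insert_subset (Finset.mem_sdiff.1 hz').1 (subset_G_of_mem_thinMembers hB')
    have hRV : R ⊆ G \ coloops M G := fun r hr =>
      Finset.mem_sdiff.2 ⟨hQ'G (Finset.mem_sdiff.1 (hRQ hr)).1, (Finset.mem_sdiff.1 (hRQ hr)).2⟩
    have hW := card_sdiff_insert_eq_card_sub_six hG hd hk hB hnP hz
    have hk1 : (coloops M G).card = 1 := by
      rw [← kColoops_eq_card_coloops]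
      exact hk
    have hKG : coloops M G ⊆ G := by
      unfold coloops
      exact Finset.filter_subset _ _
    have hV : (G \ coloops M G).card = G.card - 1 := by
      rw [Finset.card_sdiff_of_subset hKG, hk1]
    have h6 : ((G \ coloops M G) ∩ clF M R).card = 6 := by omega
    have hcl := clF_eq_of_six_lines hG hd hk hs hl hnf h15 hB₀ hbig₀ hz₀ hloss₀ hRQ₀ hR2₀ hRcard₀ hempty₀ h6₀
      hR2 hRV h6
    -- `V ∩ cl R = R` (same cardinality), so `R₀`'s line minus `Q` is `R ∖ Q ⊆ Y`
    have hRsub' : R ⊆ (G \ coloops M G) ∩ clF M R := fun r hr =>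
      Finset.mem_inter.2 ⟨hRV hr, subset_clF_of_subset_gr (hRV.trans (Finset.sdiff_subset.trans hGg)) hr⟩
    have hReq : (G \ coloops M G) ∩ clF M R = R := (Finset.eq_of_subset_of_card_le hRsub' (by omega)).symm
    refine ⟨by omega, ?_⟩
    rw [hcl, hReq]
    exact hRsub

/-- **`ntpIncomeX` is antitone in the class sizes.** -/
theorem ntpIncomeX_anti_e {N s d₁ d₂ e₁ e₂ e₁' e₂' x : ℕ} (h₁ : e₁ ≤ e₁') (h₂ : e₂ ≤ e₂') :
    ntpIncomeX N s d₁ d₂ e₁' e₂' x ≤ ntpIncomeX N s d₁ d₂ e₁ e₂ x := by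
  unfold ntpIncomeX
  apply Finset.sum_le_sum
  intro i _
  by_cases hsi : s ≤ i
  · rw [if_pos hsi, if_pos hsi]
    set w : ℚ := (if N ≤ i + 3 then (1 : ℚ) else 11 / 18) with hw
    set c : ℚ := (if N ≤ i + 3 then (0 : ℚ) else 5 * (((N - 2).choose i : ℕ) : ℚ)) with hc
    set t : ℕ := (if i = s then x else 0) with ht
    have hb : ((suspBound N i d₁ d₂ e₁ e₂ + t : ℕ) : ℚ) ≤ ((suspBound N i d₁ d₂ e₁' e₂' + t : ℕ) : ℚ) := by
      have := suspBound_mono_e (N := N) (i := i) (d₁ := d₁) (d₂ := d₂) h₁ h₂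
      exact_mod_cast Nat.add_le_add_right this t
    have hw0 : 0 ≤ w := by
      rw [hw]
      split_ifs <;> norm_num
    have hC : (0 : ℚ) ≤ 3 / (((i + 5).choose 4 : ℕ) : ℚ) := by positivity
    have hmax : max 0 (((N.choose i : ℕ) : ℚ) - c - ((suspBound N i d₁ d₂ e₁' e₂' + t : ℕ) : ℚ)) ≤
        max 0 (((N.choose i : ℕ) : ℚ) - c - ((suspBound N i d₁ d₂ e₁ e₂ + t : ℕ) : ℚ)) := by
      apply max_le_max (le_refl 0)
      linarith
    calc w * max 0 (((N.choose i : ℕ) : ℚ) - c - ((suspBound N i d₁ d₂ e₁' e₂' + t : ℕ) : ℚ)) * 3 /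
          (((i + 5).choose 4 : ℕ) : ℚ)
        = (w * max 0 (((N.choose i : ℕ) : ℚ) - c - ((suspBound N i d₁ d₂ e₁' e₂' + t : ℕ) : ℚ))) *
            (3 / (((i + 5).choose 4 : ℕ) : ℚ)) := by ring
      _ ≤ (w * max 0 (((N.choose i : ℕ) : ℚ) - c - ((suspBound N i d₁ d₂ e₁ e₂ + t : ℕ) : ℚ))) *
            (3 / (((i + 5).choose 4 : ℕ) : ℚ)) := by
          apply mul_le_mul_of_nonneg_right _ hC
          exact mul_le_mul_of_nonneg_left hmax hw0
      _ = w * max 0 (((N.choose i : ℕ) : ℚ) - c - ((suspBound N i d₁ d₂ e₁ e₂ + t : ℕ) : ℚ)) * 3 /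
            (((i + 5).choose 4 : ℕ) : ℚ) := by ring
  · rw [if_neg hsi, if_neg hsi]

/-- `ntpIncomeX` is symmetric in the two basis-line sizes. -/
theorem ntpIncomeX_comm (N s d₁ d₂ e₁ e₂ x : ℕ) : ntpIncomeX N s d₁ d₂ e₁ e₂ x = ntpIncomeX N s d₂ d₁ e₁ e₂ x := by
  unfold ntpIncomeX
  apply Finset.sum_congr rfl
  intro i _
  have h : suspBound N i d₁ d₂ e₁ e₂ = suspBound N i d₂ d₁ e₁ e₂ := by
    unfold suspBound
    ring
  rw [h]

/-- The cell `(0, 0, 8, 0; 15)` at `N = 10`, `s = 6`: `8971/8580`. -/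
theorem one_le_ntpIncomeX_ten_zero_eight : 1 ≤ ntpIncomeX 10 6 0 0 8 0 15 := by
  unfold ntpIncomeX suspBound
  simp only [Finset.sum_range_succ, Finset.sum_range_zero]
  norm_num [Nat.choose, max_def]

/-- The cell `(5, 0, 8, 0; 15)`: `13099/12870`. -/
theorem one_le_ntpIncomeX_ten_five_eight : 1 ≤ ntpIncomeX 10 6 5 0 8 0 15 := by
  unfold ntpIncomeX suspBound
  simp only [Finset.sum_range_succ, Finset.sum_range_zero]
  norm_num [Nat.choose, max_def]

/-- The cell `(6, 0, 7, 0; 15)`: `2447/2340`. -/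
theorem one_le_ntpIncomeX_ten_six_seven : 1 ≤ ntpIncomeX 10 6 6 0 7 0 15 := by
  unfold ntpIncomeX suspBound
  simp only [Finset.sum_range_succ, Finset.sum_range_zero]
  norm_num [Nat.choose, max_def]

/-- The cell `(5, 5, 6, 0; 15)`: `1535/1287`. -/
theorem one_le_ntpIncomeX_ten_five_five_six : 1 ≤ ntpIncomeX 10 6 5 5 6 0 15 := by
  unfold ntpIncomeX suspBound
  simp only [Finset.sum_range_succ, Finset.sum_range_zero]
  norm_num [Nat.choose, max_def]

/-- The arithmetic of the `N = 10` cells with the six-line exclusion. -/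
theorem one_le_ntpIncomeX_ten_of (d₁ d₂ e : ℕ) (h₁ : d₁ = 0 ∨ (5 ≤ d₁ ∧ d₁ ≤ 6)) (h₂ : d₂ = 0 ∨ (5 ≤ d₂ ∧ d₂ ≤ 6))
    (hsum : d₁ + d₂ ≤ 10) (he : e ≤ 8) (h6 : 6 ≤ d₁ ∨ 6 ≤ d₂ → e ≤ 7) (h55 : 5 ≤ d₁ → 5 ≤ d₂ → e ≤ 6) :
    1 ≤ ntpIncomeX 10 6 d₁ d₂ e 0 15 := by
  rcases h₁ with rfl | ⟨h5, h6'⟩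
  · rcases h₂ with rfl | ⟨h5', h6''⟩
    · exact le_trans one_le_ntpIncomeX_ten_zero_eight (ntpIncomeX_anti_e he le_rfl)
    · interval_cases d₂
      · rw [ntpIncomeX_comm]
        exact le_trans one_le_ntpIncomeX_ten_five_eight (ntpIncomeX_anti_e he le_rfl)
      · rw [ntpIncomeX_comm]
        exact le_trans one_le_ntpIncomeX_ten_six_seven (ntpIncomeX_anti_e (h6 (Or.inr le_rfl)) le_rfl)
  · rcases h₂ with rfl | ⟨h5', h6''⟩
    · interval_cases d₁
      · exact le_trans one_le_ntpIncomeX_ten_five_eight (ntpIncomeX_anti_e he le_rfl)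
      · exact le_trans one_le_ntpIncomeX_ten_six_seven (ntpIncomeX_anti_e (h6 (Or.inl le_rfl)) le_rfl)
    · interval_cases d₁ <;> interval_cases d₂
      · exact le_trans one_le_ntpIncomeX_ten_five_five_six (ntpIncomeX_anti_e (h55 le_rfl le_rfl) le_rfl)
      all_goals omega

end PercRepro.Shadow
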